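import Literature.MathematicalPhysics.QuantumFieldTheory.ConformalBootstrap3D.BlockConjugationSymmetry
import Literature.MathematicalPhysics.QuantumFieldTheory.ConformalBootstrap3D.BlockRadialCoordinate
import HarnessLib

/-!
# The Dolan–Osborn `1 ↔ 2` exchange symmetry `x ↦ x/(x-1)` of the typed 3D Casimir equation

Dolan–Osborn 2011 §2, eq. (2.23) (TeX label `\symF{a}`; the first of the two "symmetry relations under
`1 ↔ 2` and `3 ↔ 4`" that "follow directly" from the four-point prefactor (2.22)):

  `F_{λ₁λ₂}(a,b;x',x̄') = (-1)^ℓ v^b F_{λ₁λ₂}(-a,b;x,x̄)`,  `x' = x/(x-1)`, `x̄' = x̄/(x̄-1)`,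
  `v = (1-x)(1-x̄)`,

and (`\symF{b}`) `F_{λ₁λ₂}(a,b;x',x̄') = (-1)^ℓ v^a F_{λ₁λ₂}(a,-b;x,x̄)`. In the tree's conventions
(`SigmaEpsilonSystem`: `a = -Δ₁₂/2`, `b = Δ₃₄/2`; `CasimirEq3D Δ₁₂ Δ₃₄ Δ ℓ g z z̄` is the quadratic Casimir
equation `Δ^{(1/2)}(a,b) g = c g` multiplied through by `(z - z̄)`) the map `x ↦ x/(x-1)` is the radial
reflection `ρ ↦ -ρ` (`BlockRadialCoordinate.div_self_sub_one_eq_zOfRho_neg_rhoOf`: `x/(x-1) = z(-ρ(x))`)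
and sends the square `(0,1)²` to `(-∞,0)²`, where the typed block predicate says nothing; the global relation
(2.23) is therefore NOT a statement about `IsConformalBlock3D` (it needs the continuation of the block through
the `ρ`-bidisc — pub-ising3d AXIOMS-SOURCES §22, RECIPE R20). What IS a theorem about the typed objects, and is
proved here, is its infinitesimal content — the COVARIANCE OF THE TYPED CASIMIR EXPRESSION under the exchange
map with the printed prefactor:

* `casimirExpr3D` — the left-hand side of `CasimirEq3D` as a real number (`casimirEq3D_iff`).
* `moebiusExch x = x/(x-1)` (an involution of `ℝ ∖ {1}`, derivative `-1/(x-1)²`, `= zOfRho (-rhoOf x)` on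
  `x < 1`), `exchTransform β g (y,ȳ) = (1-y)^{-β}(1-ȳ)^{-β} g(y', ȳ')` (`= v^{-β}·g∘exch` for `y, ȳ < 1`,
  `exchTransform_eq`).
* `exch_slice_deriv` — first and second `deriv` of a slice `s ↦ K (1-s)^{-β} φ(s/(s-1))` at `y < 1` from
  first derivatives of `φ` near `y' = y/(y-1)` and a second derivative at `y'` (chain rule through the
  exchange map; the pattern of `BlockConjugationSymmetry.dolanOsbornD_conj`).
* **`casimirExpr3D_exchTransform`** — for `y, ȳ < 1` and `g` twice differentiable in each variable at
  `(y', ȳ')` (first partials near, second partials at the point):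
  `casimirExpr3D Δ₁₂ Δ₃₄ Δ ℓ (exchTransform (Δ₃₄/2) g) y ȳ
     = -(v^{-Δ₃₄/2} · v) · casimirExpr3D (-Δ₁₂) Δ₃₄ Δ ℓ g y' ȳ'`, `v = (1-y)(1-ȳ)` —
  i.e. `Δ^{(1/2)}(a,b)[v^{-b} g∘exch] - c v^{-b} g∘exch = -v^{1-b}·([Δ^{(1/2)}(-a,b) g - c g]∘exch)` after the
  `(z - z̄)` normalisation (note `y' - ȳ' = -(y - ȳ)/v`). Hence (`casimirEq3D_exchTransform_iff`)
  **`g` solves the `(-Δ₁₂, Δ₃₄)` Casimir equation at the reflected point iff `v^{-Δ₃₄/2}·g∘exch` solves the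
  `(Δ₁₂, Δ₃₄)` equation at `(y, ȳ)`** — eq. (2.23) `\symF{a}` at the level of the differential equation; the
  `\symF{b}` form `casimirExpr3D_exchTransform'` (prefactor `v^{Δ₁₂/2}`, parameters `(Δ₁₂, -Δ₃₄)`) follows from
  the `a ↔ b` symmetry of `dolanOsbornD` (`casimirExpr3D_swap`).
* `casimirEq3D_sigmaEps_exch_iff` — the `σ–ε` odd pair: with `s = Δ_σ - Δ_ε`, a function solves the `⟨εσσε⟩`
  equation (`(Δ₁₂,Δ₃₄) = (-s,s)`) at `(y',ȳ')` iff `v^{-s/2}` times its pull-back solves the `⟨σεσε⟩` equation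
  (`(s,s)`) at `(y,ȳ)`: the differential-equation half of the identification
  `g^{s,s}(z,z̄) = (-1)^ℓ v^{-s/2} g^{-s,s}(z/(z-1), z̄/(z̄-1))` used by the radial-frame odd sector
  (`MixedOddRadial.HasSignedRadialExpansion`, pub-ising3d RADIAL-FRAME-DESIGN (F2)); the other half
  (continuation + boundary condition + uniqueness) is NOT proved here.

The identity was first obtained symbolically (pub-ising3d HOME/pub-ising3d-lit-g15/code/do_symmetry_check.py,
sympy 1.14: `E[a,b](v^{-b} g∘exch)/E[-a,b](g)∘exch = -v^{1-b}`); the Lean proof is `field_simp; ring` after the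
chain rule. No series, no named fact.

References: F. A. Dolan, H. Osborn, *Conformal partial waves: further mathematical results*, arXiv:1108.6194,
§2 eqs. (2.22)–(2.23) [cite: DolanOsborn2011, §2 eq. (2.23)]; M. Hogervorst, S. Rychkov, Phys. Rev. D 87 (2013)
106004, §3 (the `ρ` coordinate; `x/(x-1) ↔ -ρ`) [cite: HogervorstRychkov2013, §3 eq. (3.1)].
-/

namespace Literature.MathematicalPhysics.QuantumFieldTheory.ConformalBootstrap3D

open Set Filter Topology

/-! ### The Casimir expression -/

/-- The left-hand side of the typed Casimir equation `CasimirEq3D Δ₁₂ Δ₃₄ Δ ℓ g z z̄` as a real number: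
`(z - z̄)[D_z g + D_z̄ g - c g] + z z̄[(1-z)∂_z g - (1-z̄)∂_z̄ g]`, `D = dolanOsbornD (-Δ₁₂/2) (Δ₃₄/2)`.
[cite: DolanOsborn2011, §2 eqs. (2.10)–(2.12)] -/
noncomputable def casimirExpr3D (Δ₁₂ Δ₃₄ Δ : ℝ) (ℓ : ℕ) (g : ℝ → ℝ → ℝ) (z zb : ℝ) : ℝ :=
  (z - zb) * (dolanOsbornD (-Δ₁₂ / 2) (Δ₃₄ / 2) (fun t => g t zb) z
        + dolanOsbornD (-Δ₁₂ / 2) (Δ₃₄ / 2) (fun t => g z t) zb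
        - casimirEigenvalue3D Δ ℓ * g z zb)
      + z * zb * ((1 - z) * deriv (fun t => g t zb) z - (1 - zb) * deriv (fun t => g z t) zb)

/-- `CasimirEq3D` is the vanishing of `casimirExpr3D`. [folklore] -/
theorem casimirEq3D_iff (Δ₁₂ Δ₃₄ Δ : ℝ) (ℓ : ℕ) (g : ℝ → ℝ → ℝ) (z zb : ℝ) :
    CasimirEq3D Δ₁₂ Δ₃₄ Δ ℓ g z zb ↔ casimirExpr3D Δ₁₂ Δ₃₄ Δ ℓ g z zb = 0 :=
  Iff.rfl

/-- `D_x(a,b) = D_x(b,a)`. [folklore] -/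
theorem dolanOsbornD_swap (a b : ℝ) (f : ℝ → ℝ) (x : ℝ) :
    dolanOsbornD a b f x = dolanOsbornD b a f x := by
  unfold dolanOsbornD
  ring

/-- The `a ↔ b` symmetry of the Casimir expression: `(Δ₁₂, Δ₃₄) ↦ (-Δ₃₄, -Δ₁₂)` leaves it unchanged
(`a = -Δ₁₂/2 ↔ b = Δ₃₄/2`). [cite: DolanOsborn2011, §2 eq. (2.11)] -/
theorem casimirExpr3D_swap (Δ₁₂ Δ₃₄ Δ : ℝ) (ℓ : ℕ) (g : ℝ → ℝ → ℝ) (z zb : ℝ) :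
    casimirExpr3D Δ₁₂ Δ₃₄ Δ ℓ g z zb = casimirExpr3D (-Δ₃₄) (-Δ₁₂) Δ ℓ g z zb := by
  simp only [casimirExpr3D, dolanOsbornD_swap (-Δ₁₂ / 2) (Δ₃₄ / 2), neg_neg]

/-! ### The exchange map `x ↦ x/(x-1)` -/

/-- The `1 ↔ 2` exchange map on cross-ratios, `x' = x/(x-1)` (Dolan–Osborn 2011, after eq. (2.23)).
[cite: DolanOsborn2011, §2 eq. (2.23)] -/
noncomputable def moebiusExch (x : ℝ) : ℝ := x / (x - 1)

/-- `moebiusExch` unfolded. [cite: DolanOsborn2011, §2 eq. (2.23)] -/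
theorem moebiusExch_def (x : ℝ) : moebiusExch x = x / (x - 1) := rfl

/-- `x' = 1 + 1/(x-1)`. [folklore] -/
theorem moebiusExch_eq_one_add {x : ℝ} (hx : x ≠ 1) : moebiusExch x = 1 + 1 / (x - 1) := by
  have h : x - 1 ≠ 0 := sub_ne_zero.mpr hx
  rw [moebiusExch_def, one_add_div h]
  congr 1
  ring

/-- `1 - x' = 1/(1-x)`. [folklore] -/
theorem one_sub_moebiusExch {x : ℝ} (hx : x ≠ 1) : 1 - moebiusExch x = 1 / (1 - x) := by
  have h : x - 1 ≠ 0 := sub_ne_zero.mpr hx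
  have h' : (1 : ℝ) - x ≠ 0 := fun h0 => h (by linarith)
  rw [moebiusExch_def, one_sub_div h, div_eq_div_iff h h']
  ring

/-- `x' ≠ 1`. [folklore] -/
theorem moebiusExch_ne_one {x : ℝ} (hx : x ≠ 1) : moebiusExch x ≠ 1 := by
  intro h1
  have h : x - 1 ≠ 0 := sub_ne_zero.mpr hx
  have h2 : x = x - 1 := (div_eq_one_iff_eq h).mp h1
  linarith

/-- The exchange map is an involution of `ℝ ∖ {1}`. [folklore] -/
theorem moebiusExch_moebiusExch {x : ℝ} (hx : x ≠ 1) : moebiusExch (moebiusExch x) = x := by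
  have h : x - 1 ≠ 0 := sub_ne_zero.mpr hx
  rw [moebiusExch_def, moebiusExch_def, div_sub_one h, show x - (x - 1) = (1 : ℝ) by ring,
    div_div_eq_mul_div, div_one, div_mul_cancel₀ x h]

/-- On `x < 1` the exchange map is the radial reflection: `x/(x-1) = z(-ρ(x))` (Hogervorst–Rychkov 2013 §3;
tree `div_self_sub_one_eq_zOfRho_neg_rhoOf`). [cite: HogervorstRychkov2013, §3 eq. (3.1)] -/
theorem moebiusExch_eq_zOfRho_neg_rhoOf {x : ℝ} (hx : x < 1) : moebiusExch x = zOfRho (-rhoOf x) :=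
  div_self_sub_one_eq_zOfRho_neg_rhoOf hx

/-- `(0,1)` is mapped into `(-∞,0)`. [folklore] -/
theorem moebiusExch_neg {x : ℝ} (hx0 : 0 < x) (hx1 : x < 1) : moebiusExch x < 0 :=
  div_neg_of_pos_of_neg hx0 (by linarith)

/-- `(-∞,0)` is mapped into `(0,1)`. [folklore] -/
theorem moebiusExch_mem_Ioo {x : ℝ} (hx : x < 0) : moebiusExch x ∈ Ioo (0 : ℝ) 1 := by
  have h1 : x - 1 < 0 := by linarith
  refine ⟨div_pos_of_neg_of_neg hx h1, ?_⟩
  rw [moebiusExch_def, div_lt_one_of_neg h1]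
  linarith

/-- `d/dx [x/(x-1)] = -1/(x-1)²`. [folklore] -/
theorem hasDerivAt_moebiusExch {x : ℝ} (hx : x ≠ 1) :
    HasDerivAt moebiusExch (-1 / (x - 1) ^ 2) x := by
  have h : x - 1 ≠ 0 := sub_ne_zero.mpr hx
  have hd := (hasDerivAt_id' x).fun_div ((hasDerivAt_id' x).sub_const 1) h
  have e : moebiusExch = fun y : ℝ => y / (y - 1) := rfl
  rw [e]
  exact hd.congr_deriv (by ring)

/-- `d/dx [-1/(x-1)²] = 2/(x-1)³`. [folklore] -/
theorem hasDerivAt_moebiusExch_deriv {x : ℝ} (hx : x ≠ 1) :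
    HasDerivAt (fun y : ℝ => -1 / (y - 1) ^ 2) (2 / (x - 1) ^ 3) x := by
  have h : x - 1 ≠ 0 := sub_ne_zero.mpr hx
  have h2 : (x - 1) ^ 2 ≠ 0 := pow_ne_zero 2 h
  have hp : HasDerivAt (fun y : ℝ => (y - 1) ^ 2) (2 * (x - 1)) x := by
    simpa using ((hasDerivAt_id' x).sub_const 1).fun_pow 2
  have hd := (hasDerivAt_const x (-1 : ℝ)).fun_div hp h2
  refine hd.congr_deriv ?_
  rw [div_eq_div_iff (pow_ne_zero 2 h2) (pow_ne_zero 3 h)]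
  ring

/-- The exchange map is continuous away from `1`. [folklore] -/
theorem continuousAt_moebiusExch {x : ℝ} (hx : x ≠ 1) : ContinuousAt moebiusExch x :=
  (hasDerivAt_moebiusExch hx).continuousAt

/-! ### The exchange transform `v^{-β} · g∘exch` -/

/-- `exchTransform β g (y, ȳ) = (1-y)^{-β} (1-ȳ)^{-β} g(y/(y-1), ȳ/(ȳ-1))`; for `y, ȳ < 1` this is
`v^{-β} g(y', ȳ')`, `v = (1-y)(1-ȳ)` (`exchTransform_eq`) — with `β = b = Δ₃₄/2` the right-hand side of
Dolan–Osborn's (2.23) `\symF{a}` up to the constant `(-1)^ℓ`. [cite: DolanOsborn2011, §2 eq. (2.23)] -/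
noncomputable def exchTransform (β : ℝ) (g : ℝ → ℝ → ℝ) (y yb : ℝ) : ℝ :=
  (1 - y) ^ (-β) * (1 - yb) ^ (-β) * g (moebiusExch y) (moebiusExch yb)

/-- The `v^{-β}` form on `y, ȳ ≤ 1`. [folklore] -/
theorem exchTransform_eq (β : ℝ) (g : ℝ → ℝ → ℝ) {y yb : ℝ} (hy : y ≤ 1) (hyb : yb ≤ 1) :
    exchTransform β g y yb = ((1 - y) * (1 - yb)) ^ (-β) * g (moebiusExch y) (moebiusExch yb) := by
  rw [exchTransform, Real.mul_rpow (by linarith) (by linarith)]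

/-! ### The chain rule through the exchange map (one slice) -/

/-- **First and second derivative of an exchanged slice.** For `y < 1`, a constant `K`, and `φ` with first
derivatives `dφ` near `y' = y/(y-1)` and a second derivative `φ₂` at `y'`, the slice
`ψ(s) = K·((1-s)^{-β} φ(s/(s-1)))` has
`ψ'(y) = K[β(1-y)^{-β-1} φ(y') + (1-y)^{-β} φ'(y')·(-1/(y-1)²)]` and the displayed second derivative.
[folklore] -/
theorem exch_slice_deriv (β K : ℝ) {φ dφ : ℝ → ℝ} {y φ₂ : ℝ} (hy : y < 1)
    (h₁ : ∀ᶠ X in 𝓝 (moebiusExch y), HasDerivAt φ (dφ X) X) (h₂ : HasDerivAt dφ φ₂ (moebiusExch y)) :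
    deriv (fun s => K * ((1 - s) ^ (-β) * φ (moebiusExch s))) y =
        K * (-(-β) * (1 - y) ^ (-β - 1) * φ (moebiusExch y)
          + (1 - y) ^ (-β) * (dφ (moebiusExch y) * (-1 / (y - 1) ^ 2))) ∧
      deriv (deriv (fun s => K * ((1 - s) ^ (-β) * φ (moebiusExch s)))) y =
        K * ((-(-β) * (-(-β - 1) * (1 - y) ^ (-β - 1 - 1)) * φ (moebiusExch y)
              + -(-β) * (1 - y) ^ (-β - 1) * (dφ (moebiusExch y) * (-1 / (y - 1) ^ 2)))
            + (-(-β) * (1 - y) ^ (-β - 1) * (dφ (moebiusExch y) * (-1 / (y - 1) ^ 2))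
              + (1 - y) ^ (-β) * (φ₂ * (-1 / (y - 1) ^ 2) * (-1 / (y - 1) ^ 2)
                + dφ (moebiusExch y) * (2 / (y - 1) ^ 3)))) := by
  have hy1 : y ≠ 1 := hy.ne
  -- transport `h₁` along the exchange map
  have hφm : ∀ᶠ s in 𝓝 y, HasDerivAt φ (dφ (moebiusExch s)) (moebiusExch s) :=
    (continuousAt_moebiusExch hy1).eventually h₁
  have hlt : ∀ᶠ s in 𝓝 y, s < 1 := Iio_mem_nhds hy
  -- first derivatives near `y`
  have hD1 : ∀ᶠ s in 𝓝 y, HasDerivAt (fun s => K * ((1 - s) ^ (-β) * φ (moebiusExch s)))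
      (K * (-(-β) * (1 - s) ^ (-β - 1) * φ (moebiusExch s)
        + (1 - s) ^ (-β) * (dφ (moebiusExch s) * (-1 / (s - 1) ^ 2)))) s := by
    filter_upwards [hφm, hlt] with s hs hs1
    have hc : HasDerivAt (fun s => φ (moebiusExch s)) (dφ (moebiusExch s) * (-1 / (s - 1) ^ 2)) s :=
      hs.comp s (hasDerivAt_moebiusExch hs1.ne)
    exact ((hasDerivAt_one_sub_rpow (-β) hs1).fun_mul hc).const_mul K
  -- second derivative at `y`
  have hcy : HasDerivAt (fun s => φ (moebiusExch s)) (dφ (moebiusExch y) * (-1 / (y - 1) ^ 2)) y :=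
    hφm.self_of_nhds.comp y (hasDerivAt_moebiusExch hy1)
  have hdy : HasDerivAt (fun s => dφ (moebiusExch s)) (φ₂ * (-1 / (y - 1) ^ 2)) y :=
    h₂.comp y (hasDerivAt_moebiusExch hy1)
  have hT1 : HasDerivAt (fun s => -(-β) * (1 - s) ^ (-β - 1) * φ (moebiusExch s))
      (-(-β) * (-(-β - 1) * (1 - y) ^ (-β - 1 - 1)) * φ (moebiusExch y)
        + -(-β) * (1 - y) ^ (-β - 1) * (dφ (moebiusExch y) * (-1 / (y - 1) ^ 2))) y :=
    ((hasDerivAt_one_sub_rpow (-β - 1) hy).const_mul (-(-β))).fun_mul hcy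
  have hT2 : HasDerivAt (fun s => (1 - s) ^ (-β) * (dφ (moebiusExch s) * (-1 / (s - 1) ^ 2)))
      (-(-β) * (1 - y) ^ (-β - 1) * (dφ (moebiusExch y) * (-1 / (y - 1) ^ 2))
        + (1 - y) ^ (-β) * (φ₂ * (-1 / (y - 1) ^ 2) * (-1 / (y - 1) ^ 2)
          + dφ (moebiusExch y) * (2 / (y - 1) ^ 3))) y :=
    (hasDerivAt_one_sub_rpow (-β) hy).fun_mul (hdy.fun_mul (hasDerivAt_moebiusExch_deriv hy1))
  have hD2 := (hT1.fun_add hT2).const_mul K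
  exact deriv_deriv_eq_of_hasDerivAt_near hD1 hD2

/-! ### The covariance of the Casimir expression -/

/-- **Dolan–Osborn 2011 eq. (2.23) (`\symF{a}`) for the typed Casimir expression.** For `y, ȳ < 1` and `g`
with first partial derivatives near and second partial derivatives at the reflected point
`(y', ȳ') = (y/(y-1), ȳ/(ȳ-1))` (slice by slice),
`casimirExpr3D Δ₁₂ Δ₃₄ Δ ℓ (v^{-Δ₃₄/2} g∘exch) (y,ȳ) = -(v^{-Δ₃₄/2}·v)·casimirExpr3D (-Δ₁₂) Δ₃₄ Δ ℓ g (y',ȳ')`,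
`v = (1-y)(1-ȳ)`. [cite: DolanOsborn2011, §2 eq. (2.23)] -/
theorem casimirExpr3D_exchTransform (Δ₁₂ Δ₃₄ Δ : ℝ) (ℓ : ℕ) {g : ℝ → ℝ → ℝ}
    {gX gY : ℝ → ℝ} {gXX gYY y yb : ℝ} (hy : y < 1) (hyb : yb < 1)
    (h₁ : ∀ᶠ X in 𝓝 (moebiusExch y), HasDerivAt (fun X => g X (moebiusExch yb)) (gX X) X)
    (h₁' : HasDerivAt gX gXX (moebiusExch y))
    (h₂ : ∀ᶠ Y in 𝓝 (moebiusExch yb), HasDerivAt (fun Y => g (moebiusExch y) Y) (gY Y) Y)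
    (h₂' : HasDerivAt gY gYY (moebiusExch yb)) :
    casimirExpr3D Δ₁₂ Δ₃₄ Δ ℓ (exchTransform (Δ₃₄ / 2) g) y yb =
      -((1 - y) ^ (-(Δ₃₄ / 2)) * (1 - yb) ^ (-(Δ₃₄ / 2)) * ((1 - y) * (1 - yb))) *
        casimirExpr3D (-Δ₁₂) Δ₃₄ Δ ℓ g (moebiusExch y) (moebiusExch yb) := by
  set β := Δ₃₄ / 2 with hβ
  have hy1 : y ≠ 1 := hy.ne
  have hyb1 : yb ≠ 1 := hyb.ne
  -- the two slices of the transform, in the shape of `exch_slice_deriv`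
  have eY : (fun t => exchTransform β g t yb) =
      fun s => (1 - yb) ^ (-β) * ((1 - s) ^ (-β) * g (moebiusExch s) (moebiusExch yb)) := by
    funext s; simp only [exchTransform]; ring
  have eYb : (fun t => exchTransform β g y t) =
      fun s => (1 - y) ^ (-β) * ((1 - s) ^ (-β) * g (moebiusExch y) (moebiusExch s)) := by
    funext s; simp only [exchTransform]; ring
  obtain ⟨d1, d2⟩ := exch_slice_deriv β ((1 - yb) ^ (-β)) hy h₁ h₁'
  obtain ⟨e1, e2⟩ := exch_slice_deriv β ((1 - y) ^ (-β)) hyb h₂ h₂'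
  obtain ⟨f1, f2⟩ := deriv_deriv_eq_of_hasDerivAt_near h₁ h₁'
  obtain ⟨k1, k2⟩ := deriv_deriv_eq_of_hasDerivAt_near h₂ h₂'
  unfold casimirExpr3D dolanOsbornD
  rw [eY, eYb, d1, d2, e1, e2, f1, f2, k1, k2]
  simp only [exchTransform]
  -- reduce the shifted powers
  have hw : (1 : ℝ) - y ≠ 0 := by linarith
  have hwb : (1 : ℝ) - yb ≠ 0 := by linarith
  have hv : y - 1 ≠ 0 := sub_ne_zero.mpr hy1
  have hvb : yb - 1 ≠ 0 := sub_ne_zero.mpr hyb1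
  have r1 : (1 - y) ^ (-β - 1) = (1 - y) ^ (-β) / (1 - y) := Real.rpow_sub_one hw (-β)
  have r2 : (1 - y) ^ (-β - 1 - 1) = (1 - y) ^ (-β) / (1 - y) / (1 - y) := by
    rw [Real.rpow_sub_one hw (-β - 1), r1]
  have s1 : (1 - yb) ^ (-β - 1) = (1 - yb) ^ (-β) / (1 - yb) := Real.rpow_sub_one hwb (-β)
  have s2 : (1 - yb) ^ (-β - 1 - 1) = (1 - yb) ^ (-β) / (1 - yb) / (1 - yb) := by
    rw [Real.rpow_sub_one hwb (-β - 1), s1]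
  rw [r1, r2, s1, s2]
  simp only [moebiusExch_def]
  field_simp
  ring

/-- **The exchange symmetry of the typed Casimir equation** (Dolan–Osborn 2011 (2.23) `\symF{a}`, differential
form): under the hypotheses of `casimirExpr3D_exchTransform`, `g` solves the `(-Δ₁₂, Δ₃₄)` equation at the
reflected point `(y', ȳ')` iff `v^{-Δ₃₄/2}·g∘exch` solves the `(Δ₁₂, Δ₃₄)` equation at `(y, ȳ)`.
[cite: DolanOsborn2011, §2 eq. (2.23)] -/
theorem casimirEq3D_exchTransform_iff (Δ₁₂ Δ₃₄ Δ : ℝ) (ℓ : ℕ) {g : ℝ → ℝ → ℝ}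
    {gX gY : ℝ → ℝ} {gXX gYY y yb : ℝ} (hy : y < 1) (hyb : yb < 1)
    (h₁ : ∀ᶠ X in 𝓝 (moebiusExch y), HasDerivAt (fun X => g X (moebiusExch yb)) (gX X) X)
    (h₁' : HasDerivAt gX gXX (moebiusExch y))
    (h₂ : ∀ᶠ Y in 𝓝 (moebiusExch yb), HasDerivAt (fun Y => g (moebiusExch y) Y) (gY Y) Y)
    (h₂' : HasDerivAt gY gYY (moebiusExch yb)) :
    CasimirEq3D Δ₁₂ Δ₃₄ Δ ℓ (exchTransform (Δ₃₄ / 2) g) y yb ↔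
      CasimirEq3D (-Δ₁₂) Δ₃₄ Δ ℓ g (moebiusExch y) (moebiusExch yb) := by
  rw [casimirEq3D_iff, casimirEq3D_iff, casimirExpr3D_exchTransform Δ₁₂ Δ₃₄ Δ ℓ hy hyb h₁ h₁' h₂ h₂',
    mul_eq_zero]
  have hne : -((1 - y) ^ (-(Δ₃₄ / 2)) * (1 - yb) ^ (-(Δ₃₄ / 2)) * ((1 - y) * (1 - yb))) ≠ 0 := by
    have h1 : 0 < 1 - y := by linarith
    have h2 : 0 < 1 - yb := by linarith
    have : 0 < (1 - y) ^ (-(Δ₃₄ / 2)) * (1 - yb) ^ (-(Δ₃₄ / 2)) * ((1 - y) * (1 - yb)) :=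
      mul_pos (mul_pos (Real.rpow_pos_of_pos h1 _) (Real.rpow_pos_of_pos h2 _)) (mul_pos h1 h2)
    linarith
  exact ⟨fun h => h.resolve_left hne, fun h => Or.inr h⟩

/-- **Dolan–Osborn 2011 eq. (2.23) (`\symF{b}`) for the typed Casimir expression**: the transform
`v^{-a}·g∘exch` with `a = -Δ₁₂/2`, i.e. `exchTransform (-Δ₁₂/2) g = v^{Δ₁₂/2} g∘exch`, and parameters
`(a,-b) ↔ (Δ₁₂, -Δ₃₄)`:
`casimirExpr3D Δ₁₂ Δ₃₄ (v^{Δ₁₂/2} g∘exch)(y,ȳ) = -(v^{Δ₁₂/2}·v)·casimirExpr3D Δ₁₂ (-Δ₃₄) g (y',ȳ')`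
(from `\symF{a}` by the `a ↔ b` symmetry `casimirExpr3D_swap`). [cite: DolanOsborn2011, §2 eq. (2.23)] -/
theorem casimirExpr3D_exchTransform' (Δ₁₂ Δ₃₄ Δ : ℝ) (ℓ : ℕ) {g : ℝ → ℝ → ℝ}
    {gX gY : ℝ → ℝ} {gXX gYY y yb : ℝ} (hy : y < 1) (hyb : yb < 1)
    (h₁ : ∀ᶠ X in 𝓝 (moebiusExch y), HasDerivAt (fun X => g X (moebiusExch yb)) (gX X) X)
    (h₁' : HasDerivAt gX gXX (moebiusExch y))
    (h₂ : ∀ᶠ Y in 𝓝 (moebiusExch yb), HasDerivAt (fun Y => g (moebiusExch y) Y) (gY Y) Y)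
    (h₂' : HasDerivAt gY gYY (moebiusExch yb)) :
    casimirExpr3D Δ₁₂ Δ₃₄ Δ ℓ (exchTransform (-Δ₁₂ / 2) g) y yb =
      -((1 - y) ^ (-(-Δ₁₂ / 2)) * (1 - yb) ^ (-(-Δ₁₂ / 2)) * ((1 - y) * (1 - yb))) *
        casimirExpr3D Δ₁₂ (-Δ₃₄) Δ ℓ g (moebiusExch y) (moebiusExch yb) := by
  rw [casimirExpr3D_swap Δ₁₂ Δ₃₄, casimirExpr3D_exchTransform (-Δ₃₄) (-Δ₁₂) Δ ℓ hy hyb h₁ h₁' h₂ h₂',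
    neg_neg, casimirExpr3D_swap Δ₃₄ (-Δ₁₂), neg_neg]

/-- **The `σ–ε` odd pair** (`s = Δ_σ - Δ_ε`; `⟨εσσε⟩ ↔ (Δ₁₂,Δ₃₄) = (-s,s)`, `⟨σεσε⟩ ↔ (s,s)`): under the
regularity hypotheses, `g` solves the `⟨εσσε⟩` Casimir equation at the reflected point `(y',ȳ') ∈ (-∞,0)²`
iff `v^{-s/2}·g∘exch` solves the `⟨σεσε⟩` equation at `(y,ȳ)` — the differential-equation content of
`g^{s,s} = (-1)^ℓ v^{-s/2} g^{-s,s}∘exch` (pub-ising3d RADIAL-FRAME-DESIGN (F2); `MixedOddRadial`).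
[cite: DolanOsborn2011, §2 eq. (2.23)] -/
theorem casimirEq3D_sigmaEps_exch_iff (Δσ Δε Δ : ℝ) (ℓ : ℕ) {g : ℝ → ℝ → ℝ}
    {gX gY : ℝ → ℝ} {gXX gYY y yb : ℝ} (hy : y < 1) (hyb : yb < 1)
    (h₁ : ∀ᶠ X in 𝓝 (moebiusExch y), HasDerivAt (fun X => g X (moebiusExch yb)) (gX X) X)
    (h₁' : HasDerivAt gX gXX (moebiusExch y))
    (h₂ : ∀ᶠ Y in 𝓝 (moebiusExch yb), HasDerivAt (fun Y => g (moebiusExch y) Y) (gY Y) Y)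
    (h₂' : HasDerivAt gY gYY (moebiusExch yb)) :
    CasimirEq3D (Δσ - Δε) (Δσ - Δε) Δ ℓ (exchTransform ((Δσ - Δε) / 2) g) y yb ↔
      CasimirEq3D (-(Δσ - Δε)) (Δσ - Δε) Δ ℓ g (moebiusExch y) (moebiusExch yb) :=
  casimirEq3D_exchTransform_iff (Δσ - Δε) (Δσ - Δε) Δ ℓ hy hyb h₁ h₁' h₂ h₂'

end Literature.MathematicalPhysics.QuantumFieldTheory.ConformalBootstrap3D
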